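import Mathlib
import Summits.Ventures.HodgeRepro2.T5CornerSimple
import Summits.Ventures.HodgeRepro2.T5DixmierSchur
import Summits.Ventures.HodgeRepro2.T5SchurRepresentation

/-!
# Smooth modules over an algebra with a directed family of idempotents (the Hecke-algebra side)

Blind cell `pub-hodge-repro2`, seat p8 (gen 5), Tier-5 kernel support.  On the group side,
`T5SchurRepresentation` / `T5VanDantzig` treat a smooth representation through its invariants
`V^K` along a countable basis of open compact subgroups.  On the Hecke-algebra side (the language
of MVW chap. 2 III and of `T5CornerSimple`, p392753) the same structure is carried by the
averaging idempotents `e_K ∈ H(G)`: `V^K = e_K • V`, `K' ⊆ K ⇒ e_K = e_{K'} e_K = e_K e_{K'}`, and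
smoothness says `V = ⋃_K e_K • V`.  This file records that dictionary in kernel form for a
`k`-algebra `R` with a DIRECTED family of idempotents `e i` (`e j * e i = e i = e i * e j` for
`i ≤ j`):

* `cornerSubmodule e M` — `e • M` as a `k`-subspace (`R` a `k`-algebra);
* `cornerModule_mono` — `e i • M ⊆ e j • M` for `i ≤ j`;
* `IsSmoothModule` — every vector is fixed by some `e i`; `iSup_cornerSubmodule_eq_top`;
* `rank_le_aleph0_of_isSmoothModule` — finite-dimensional corners along a COUNTABLE family
  ⇒ countable dimension (the admissible-⇒-countable-dimension feeder, Hecke side), and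
  `exists_smul_eq_of_isSmoothModule` — Schur (Dixmier) for a simple smooth admissible module over
  an uncountable algebraically closed field;
* `cornerInclusion` — the corner ring `e i R e i` sits inside `e j R e j` for `i ≤ j`
  (an injective non-unital ring homomorphism; `1_{e_i R e_i} = e_i` is not the unit of
  `e_j R e_j`).

In the record: `R = H(G)⁺` (unitalised Hecke algebra), `e i = e_{K_i}` for a countable decreasing
basis `K_i` of compact open subgroups (`T5VanDantzig.exists_countable_basis_compact_openSubgroup`),
`M = π` smooth, `e_{K_i} • π = π^{K_i}`.  What stays prose: the identification of smooth
representations with non-degenerate `H(G)`-modules.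

README §8(d): uses an L-value-free non-vanishing device: NO.
-/

namespace Summit.Ventures.HodgeRepro2.T5CornerSmooth

open Cardinal
open Summit.Ventures.HodgeRepro2.T5CornerSimple

section Subspace

variable {k R : Type*} [Field k] [Ring R] [Algebra k R] {M : Type*} [AddCommGroup M]
  [Module R M] [Module k M] [IsScalarTower k R M]

/-- `e • M` as a `k`-subspace of `M` (`R` a `k`-algebra). -/
def cornerSubmodule (e : R) (M : Type*) [AddCommGroup M] [Module R M] [Module k M]
    [IsScalarTower k R M] : Submodule k M where
  carrier := cornerModule e M
  add_mem' := (cornerModule e M).add_mem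
  zero_mem' := (cornerModule e M).zero_mem
  smul_mem' c x hx := by
    rw [SetLike.mem_coe, mem_cornerModule_iff'] at hx ⊢
    obtain ⟨m, rfl⟩ := hx
    exact ⟨c • m, by rw [smul_comm]⟩

/-- `x ∈ cornerSubmodule e M ↔ x ∈ cornerModule e M`. -/
@[simp] theorem mem_cornerSubmodule_iff {e : R} {x : M} :
    x ∈ cornerSubmodule (k := k) e M ↔ x ∈ cornerModule e M := Iff.rfl

end Subspace

section Directed

variable {R : Type*} [Ring R] {ι : Type*} [Preorder ι] (e : ι → R)
  (hmono : ∀ i j, i ≤ j → e j * e i = e i ∧ e i * e j = e i)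

variable {M : Type*} [AddCommGroup M] [Module R M]

include hmono in
/-- For a directed family of idempotents, `e i • M ⊆ e j • M` when `i ≤ j`. -/
theorem cornerModule_mono {i j : ι} (hij : i ≤ j) : cornerModule (e i) M ≤ cornerModule (e j) M := by
  intro x hx
  rw [mem_cornerModule_iff'] at hx ⊢
  obtain ⟨m, rfl⟩ := hx
  exact ⟨e i • m, by rw [← mul_smul, (hmono i j hij).1]⟩

omit hmono in
/-- A module is SMOOTH for the family `e` if every vector is fixed by some `e i`. -/
def IsSmoothModule : Prop := ∀ m : M, ∃ i, e i • m = m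

omit hmono [Preorder ι] in
/-- For a smooth module, the corners exhaust `M`: `⨆ i, e i • M = ⊤` (as additive subgroups). -/
theorem iSup_cornerModule_eq_top (hs : IsSmoothModule e (M := M)) :
    ⨆ i, cornerModule (e i) M = ⊤ := by
  rw [eq_top_iff]
  intro m _
  obtain ⟨i, hi⟩ := hs m
  exact AddSubgroup.mem_iSup_of_mem i ((mem_cornerModule_iff' (e := e i)).mpr ⟨m, hi⟩)

end Directed

section Countable

variable {k R : Type*} [Field k] [Ring R] [Algebra k R] {ι : Type*} (e : ι → R)
  {M : Type*} [AddCommGroup M] [Module R M] [Module k M] [IsScalarTower k R M]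

/-- For a smooth module, the `k`-subspaces `e i • M` exhaust `M`. -/
theorem iSup_cornerSubmodule_eq_top (hs : IsSmoothModule e (M := M)) :
    ⨆ i, cornerSubmodule (k := k) (e i) M = ⊤ := by
  rw [eq_top_iff]
  intro m _
  obtain ⟨i, hi⟩ := hs m
  exact Submodule.mem_iSup_of_mem i ((mem_cornerModule_iff' (e := e i)).mpr ⟨m, hi⟩)

/-- **Admissible ⇒ countable dimension, Hecke side.** A smooth module whose corners `e i • M`
are finite-dimensional along a countable family has countable `k`-dimension. -/
theorem rank_le_aleph0_of_isSmoothModule [Countable ι] (hs : IsSmoothModule e (M := M))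
    [∀ i, FiniteDimensional k (cornerSubmodule (k := k) (e i) M)] : Module.rank k M ≤ ℵ₀ :=
  T5SchurRepresentation.rank_le_aleph0_of_iSup_eq_top_of_finite
    (fun i => cornerSubmodule (k := k) (e i) M) (iSup_cornerSubmodule_eq_top e hs)

/-- **Schur for smooth admissible simple modules (Hecke side).** Over an uncountable
algebraically closed field, every endomorphism of a simple smooth module with finite-dimensional
corners along a countable family is a scalar (`T5DixmierSchur.exists_smul_eq`). -/
theorem exists_smul_eq_of_isSmoothModule [IsAlgClosed k] (hk : ℵ₀ < #k) [IsSimpleModule R M]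
    [Countable ι] (hs : IsSmoothModule e (M := M))
    [∀ i, FiniteDimensional k (cornerSubmodule (k := k) (e i) M)] (φ : Module.End R M) :
    ∃ c : k, ∀ x, φ x = c • x :=
  T5DixmierSchur.exists_smul_eq hk (rank_le_aleph0_of_isSmoothModule e hs) φ

end Countable

section Inclusion

variable {R : Type*} [Ring R] {e f : R} (he : IsIdempotentElem e) (hf : IsIdempotentElem f)
  (hef : f * e = e ∧ e * f = e)

include hef in
/-- Elements of `eRe` lie in `fRf` when `f e = e = e f` (`i ≤ j`). -/
theorem mem_corner_of_le (c : he.Corner) : c.1 ∈ Subsemigroup.corner f := by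
  have h1 : f * c.1 = c.1 := by
    rw [← corner_mul_left he c, ← mul_assoc, hef.1]
  have h2 : c.1 * f = c.1 := by
    rw [← corner_mul_right he c, mul_assoc, hef.2]
  refine ⟨c.1, ?_⟩
  show f * c.1 * f = c.1
  rw [h1, h2]

/-- The corner ring `eRe` sits inside `fRf` when `f e = e = e f`: the inclusion as a NON-UNITAL
ring homomorphism (`1_{eRe} = e` is an idempotent of `fRf`, not its unit `f`). -/
def cornerInclusion : he.Corner →ₙ+* hf.Corner where
  toFun c := ⟨c.1, mem_corner_of_le he hef c⟩
  map_mul' _ _ := rfl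
  map_zero' := rfl
  map_add' _ _ := rfl

/-- `(cornerInclusion c).1 = c.1`. -/
@[simp] theorem cornerInclusion_val (c : he.Corner) : (cornerInclusion he hf hef c).1 = c.1 := rfl

/-- The inclusion is injective. -/
theorem cornerInclusion_injective : Function.Injective (cornerInclusion he hf hef) := by
  intro c d h
  have h' : (cornerInclusion he hf hef c).1 = (cornerInclusion he hf hef d).1 := by rw [h]
  exact Subtype.ext h'

end Inclusion

end Summit.Ventures.HodgeRepro2.T5CornerSmooth
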